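import Mathlib

/-!
# The modular line is well defined (solo-informed, §7.11 (16.3)(c) / (16.4) / (16.6)(C))

In §7.11 (16.4) the normalised Hecke residues `r̄_𝔮` at the test primes with `N𝔮 ≡ 1 (mod p)` are
fitted by `r̄_𝔮 = C′ · (x · P₁(𝔮) + y · P₂(𝔮))`, where `P₁, P₂` are the two Kummer pairings and
`(x : y) ∈ ℙ¹(𝔽_p)` is the MODULAR LINE `η_𝔪 = ε₁^x ε₂^y`, determined only up to the unknown unit `C′`.
The elementary facts used when we say a fit is "UNIQUE" are recorded here over an arbitrary field:
two rows whose `2 × 2` minor is non-zero determine `(x, y)` once `C′` is fixed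
(`soloInformed_fit_eq_of_minor_ne_zero`), and determine the POINT `(x : y)` of the projective line
independently of `C′` (`soloInformed_modularLine_wellDefined`): different admissible scalars give
proportional solutions.  This is why (16.6)(C) can compare the line fitted at the `N𝔮 ≡ 1` primes
with the line found at the `N𝔮 ≢ 1` primes although the two regimes carry different unknown scalars.
-/

namespace Summit.Langlands.Langlands.Theorems

/-- Two rows `i, j` with non-zero minor `P i * Q j - P j * Q i` determine the coefficients of a
combination `u • P + v • Q` that vanishes at both rows: `u = v = 0`. -/
theorem soloInformed_coeffs_eq_zero_of_minor_ne_zero {K : Type*} [Field K] {ι : Type*}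
    (P Q : ι → K) {i j : ι} (hD : P i * Q j - P j * Q i ≠ 0) {u v : K}
    (hi : u * P i + v * Q i = 0) (hj : u * P j + v * Q j = 0) : u = 0 ∧ v = 0 := by
  have hu : u * (P i * Q j - P j * Q i) = 0 := by
    linear_combination Q j * hi - Q i * hj
  have hv : v * (P i * Q j - P j * Q i) = 0 := by
    linear_combination P i * hj - P j * hi
  exact ⟨(mul_eq_zero.1 hu).resolve_right hD, (mul_eq_zero.1 hv).resolve_right hD⟩

/-- With the scalar fixed, two rows with non-zero minor determine the fit:
if `x P + y Q` and `x' P + y' Q` agree at rows `i, j` then `(x, y) = (x', y')`. -/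
theorem soloInformed_fit_eq_of_minor_ne_zero {K : Type*} [Field K] {ι : Type*}
    (P Q : ι → K) {i j : ι} (hD : P i * Q j - P j * Q i ≠ 0) {x y x' y' : K}
    (hi : x * P i + y * Q i = x' * P i + y' * Q i) (hj : x * P j + y * Q j = x' * P j + y' * Q j) :
    x = x' ∧ y = y' := by
  have h := soloInformed_coeffs_eq_zero_of_minor_ne_zero P Q hD (u := x - x') (v := y - y')
    (by linear_combination hi) (by linear_combination hj)
  exact ⟨sub_eq_zero.1 h.1, sub_eq_zero.1 h.2⟩

/-- §7.11 (16.3)(c): the modular line is well defined.  If the same residues `r` are fitted as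
`r = c (x P + y Q)` and as `r = c' (x' P + y' Q)` with BOTH scalars non-zero, and two rows have a
non-zero minor, then `(x, y)` and `(x', y')` are proportional: `x y' = x' y`, i.e. they define the
same point of `ℙ¹` (or are both zero). -/
theorem soloInformed_modularLine_wellDefined {K : Type*} [Field K] {ι : Type*}
    (P Q r : ι → K) {i j : ι} (hD : P i * Q j - P j * Q i ≠ 0) {c c' x y x' y' : K}
    (hc : c ≠ 0) (h : ∀ k, r k = c * (x * P k + y * Q k))
    (h' : ∀ k, r k = c' * (x' * P k + y' * Q k)) : x * y' = x' * y := by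
  -- the combination (c x - c' x') P + (c y - c' y') Q vanishes at every row
  have hrow : ∀ k, (c * x - c' * x') * P k + (c * y - c' * y') * Q k = 0 := by
    intro k
    linear_combination (h' k) - (h k)
  obtain ⟨hu, hv⟩ := soloInformed_coeffs_eq_zero_of_minor_ne_zero P Q hD (hrow i) (hrow j)
  -- so c x = c' x' and c y = c' y', whence c (x y' - x' y) = 0
  have hprod : c * (x * y' - x' * y) = 0 := by
    linear_combination y' * hu - x' * hv
  have := (mul_eq_zero.1 hprod).resolve_left hc
  exact sub_eq_zero.1 this

/-- The converse bookkeeping: proportional parameters with a compensating scalar give the same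
residues, so the fit can never do better than determine the point `(x : y)`. -/
theorem soloInformed_fit_rescale {K : Type*} [Field K] {ι : Type*} (P Q : ι → K)
    (c t x y : K) (k : ι) :
    c * ((t * x) * P k + (t * y) * Q k) = (c * t) * (x * P k + y * Q k) := by
  ring

end Summit.Langlands.Langlands.Theorems
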